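import Summits.Ventures.HodgeRepro.BallModel

/-!
# Continuity of the `U(2,1)`-action on the ball, of its Jacobian, and of the Hecke translate

Blind re-derivation cell `pub-hodge-repro`, seat `typer-2`.  Built on the sealer's `BallModel.lean`
(statement (c), the Hecke-translate wedge); Mathlib only otherwise.

Topology: `U21` is a subgroup of `GL₃(ℂ) = (Matrix (Fin 3) (Fin 3) ℂ)ˣ`, so it carries the subspace topology
of Mathlib's topology on units (`Units.instTopologicalSpace`: the coarsest topology making `g ↦ g` and
`g ↦ g⁻¹` continuous into `Matrix (Fin 3) (Fin 3) ℂ`); `Ball` carries the subspace topology of `ℂ²`.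

* `continuous_mat`, `continuous_lift`, `continuous_W3` — the ingredients of the action;
* `continuous_act` — `(g, z) ↦ g • z` is jointly continuous on `U21 × Ball`;
* `continuous_Jac` — `(g, z) ↦ J_g(z)` is jointly continuous;
* `pullback γ F z = J_γ(z)ᵀ F(γ z)` (the translate `γ^*F`), `continuous_pullback`, `continuous_wedge`,
  `continuous_wedge_pullback`;
* the one-variable versions `continuous_act_left`, `continuous_Jac_left`, `continuous_pullback_left`;
* `isOpen_wedge_ne` — for continuous `F, G` and a fixed `z`, `{γ | wedge (γ^*F z) (G z) ≠ 0}` is open in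
  `U21` (and `isOpen_wedge_ne_prod` for the pair `(γ, z)`): the set of "good translates" is open, so a
  dense subgroup meets it as soon as it is non-empty.
-/

set_option autoImplicit false

noncomputable section

namespace Summit.Ventures.HodgeRepro.BallModel

open Matrix

/-! ### The action is continuous -/

/-- `g ↦ mat g` is continuous on `U21` (subspace topology of `GL₃(ℂ)`). -/
theorem continuous_mat : Continuous (mat : U21 → Matrix (Fin 3) (Fin 3) ℂ) :=
  Units.continuous_val.comp continuous_subtype_val

/-- `z ↦ z.1` is continuous on the ball. -/
theorem continuous_ball_val : Continuous fun z : Ball => z.1 :=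
  continuous_subtype_val

/-- The lift `z ↦ (z₀, z₁, 1)` is continuous. -/
theorem continuous_lift : Continuous lift := by
  refine continuous_pi fun i => ?_
  fin_cases i
  · show Continuous fun z : Ball => z.1 0
    exact (continuous_apply 0).comp continuous_ball_val
  · show Continuous fun z : Ball => z.1 1
    exact (continuous_apply 1).comp continuous_ball_val
  · show Continuous fun _ : Ball => (1 : ℂ)
    exact continuous_const

/-- `(g, z) ↦ g · (z, 1)` is jointly continuous. -/
theorem continuous_W3 : Continuous fun p : U21 × Ball => W3 p.1 p.2 := by
  unfold W3
  exact (continuous_mat.comp continuous_fst).matrix_mulVec (continuous_lift.comp continuous_snd)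

/-- The coordinate `(g, z) ↦ (g · (z, 1))_i` is continuous. -/
theorem continuous_W3_apply (i : Fin 3) : Continuous fun p : U21 × Ball => W3 p.1 p.2 i :=
  (continuous_apply i).comp continuous_W3

/-- The coordinates of the action `(g, z) ↦ (g • z)_i = (g·(z,1))_i / (g·(z,1))₂` are continuous. -/
theorem continuous_act_coord (i : Fin 2) :
    Continuous fun p : U21 × Ball => W3 p.1 p.2 (Fin.castSucc i) / W3 p.1 p.2 2 :=
  (continuous_W3_apply _).div (continuous_W3_apply 2) fun p => W3_2_ne_zero p.1 p.2

/-- The underlying point of `act g z` is `(w₀ / w₂, w₁ / w₂)` with `w = g · (z, 1)`. -/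
theorem act_val (g : U21) (z : Ball) :
    (act g z).1 = ![W3 g z 0 / W3 g z 2, W3 g z 1 / W3 g z 2] := rfl

/-- **The action is jointly continuous**: `(g, z) ↦ g • z` is continuous on `U21 × Ball`. -/
theorem continuous_act : Continuous fun p : U21 × Ball => act p.1 p.2 := by
  refine continuous_induced_rng.2 ?_
  change Continuous fun p : U21 × Ball => (act p.1 p.2).1
  simp only [act_val]
  refine continuous_pi fun i => ?_
  fin_cases i
  · exact continuous_act_coord 0
  · exact continuous_act_coord 1

/-! ### The Jacobian is continuous -/

/-- **The Jacobian is jointly continuous**: `(g, z) ↦ J_g(z)` is continuous on `U21 × Ball`. -/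
theorem continuous_Jac : Continuous fun p : U21 × Ball => Jac p.1 p.2 := by
  unfold Jac
  refine continuous_matrix fun i j => ?_
  simp only [Matrix.of_apply]
  have hm : Continuous fun p : U21 × Ball => mat p.1 := continuous_mat.comp continuous_fst
  refine Continuous.div ?_ ((continuous_W3_apply 2).pow 2)
    fun p => pow_ne_zero 2 (W3_2_ne_zero p.1 p.2)
  exact ((hm.matrix_elem _ _).mul (continuous_W3_apply 2)).sub
    ((continuous_W3_apply _).mul (hm.matrix_elem _ _))

/-! ### The Hecke translate and the wedge -/

/-- The translate (pull-back) `γ^*F` of a cotangent field `F : 𝔹² → ℂ²` by `γ ∈ U(2,1)`: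
`(γ^*F)(z) = J_γ(z)ᵀ F(γ z)`. -/
def pullback (γ : U21) (F : Ball → Fin 2 → ℂ) (z : Ball) : Fin 2 → ℂ :=
  (Jac γ z)ᵀ *ᵥ F (act γ z)

/-- `pullback γ F z = J_γ(z)ᵀ F(γ z)`. -/
theorem pullback_apply (γ : U21) (F : Ball → Fin 2 → ℂ) (z : Ball) :
    pullback γ F z = (Jac γ z)ᵀ *ᵥ F (act γ z) := rfl

/-- The translate of a continuous field is jointly continuous in `(γ, z)`. -/
theorem continuous_pullback {F : Ball → Fin 2 → ℂ} (hF : Continuous F) :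
    Continuous fun p : U21 × Ball => (Jac p.1 p.2)ᵀ *ᵥ F (act p.1 p.2) :=
  continuous_Jac.matrix_transpose.matrix_mulVec (hF.comp continuous_act)

/-- The wedge `(a, b) ↦ a₀ b₁ - a₁ b₀` is continuous. -/
theorem continuous_wedge : Continuous fun p : (Fin 2 → ℂ) × (Fin 2 → ℂ) => wedge p.1 p.2 := by
  unfold wedge
  fun_prop

/-- `(γ, z) ↦ wedge (γ^*F z) (G z)` is jointly continuous for continuous `F, G`. -/
theorem continuous_wedge_pullback {F G : Ball → Fin 2 → ℂ} (hF : Continuous F) (hG : Continuous G) :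
    Continuous fun p : U21 × Ball => wedge ((Jac p.1 p.2)ᵀ *ᵥ F (act p.1 p.2)) (G p.2) :=
  continuous_wedge.comp ((continuous_pullback hF).prodMk (hG.comp continuous_snd))

/-! ### One-variable versions (fixed point `z`, varying `γ`) -/

/-- The inclusion `γ ↦ (γ, z)` is continuous. -/
theorem continuous_pair_const (z : Ball) : Continuous fun γ : U21 => (γ, z) :=
  Continuous.prodMk continuous_id continuous_const

/-- For fixed `z`, `γ ↦ γ • z` is continuous. -/
theorem continuous_act_left (z : Ball) : Continuous fun γ : U21 => act γ z :=
  Continuous.comp (f := fun γ : U21 => (γ, z)) (g := fun p : U21 × Ball => act p.1 p.2)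
    continuous_act (continuous_pair_const z)

/-- For fixed `z`, `γ ↦ J_γ(z)` is continuous. -/
theorem continuous_Jac_left (z : Ball) : Continuous fun γ : U21 => Jac γ z :=
  Continuous.comp (f := fun γ : U21 => (γ, z)) (g := fun p : U21 × Ball => Jac p.1 p.2)
    continuous_Jac (continuous_pair_const z)

/-- For fixed `z` and continuous `F`, `γ ↦ (γ^*F)(z)` is continuous. -/
theorem continuous_pullback_left {F : Ball → Fin 2 → ℂ} (hF : Continuous F) (z : Ball) :
    Continuous fun γ : U21 => (Jac γ z)ᵀ *ᵥ F (act γ z) :=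
  Continuous.comp (f := fun γ : U21 => (γ, z))
    (g := fun p : U21 × Ball => (Jac p.1 p.2)ᵀ *ᵥ F (act p.1 p.2))
    (continuous_pullback hF) (continuous_pair_const z)

/-- For fixed `z` and continuous `F, G`, `γ ↦ wedge ((γ^*F) z) (G z)` is continuous. -/
theorem continuous_wedge_pullback_left {F G : Ball → Fin 2 → ℂ} (hF : Continuous F) (hG : Continuous G)
    (z : Ball) : Continuous fun γ : U21 => wedge ((Jac γ z)ᵀ *ᵥ F (act γ z)) (G z) :=
  Continuous.comp (f := fun γ : U21 => (γ, z))
    (g := fun p : U21 × Ball => wedge ((Jac p.1 p.2)ᵀ *ᵥ F (act p.1 p.2)) (G p.2))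
    (continuous_wedge_pullback hF hG) (continuous_pair_const z)

/-! ### The good translates form an open set -/

/-- For continuous `F, G` and a fixed `z`, the set of `γ ∈ U(2,1)` whose translate of `F` has a non-zero
wedge with `G` at `z` is open. -/
theorem isOpen_wedge_ne {F G : Ball → Fin 2 → ℂ} (hF : Continuous F) (hG : Continuous G) (z : Ball) :
    IsOpen {γ : U21 | wedge ((Jac γ z)ᵀ *ᵥ F (act γ z)) (G z) ≠ 0} :=
  isOpen_ne_fun (continuous_wedge_pullback_left hF hG z) continuous_const

/-- The pairs `(γ, z)` with a non-zero wedge form an open subset of `U21 × Ball`. -/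
theorem isOpen_wedge_ne_prod {F G : Ball → Fin 2 → ℂ} (hF : Continuous F) (hG : Continuous G) :
    IsOpen {p : U21 × Ball | wedge ((Jac p.1 p.2)ᵀ *ᵥ F (act p.1 p.2)) (G p.2) ≠ 0} :=
  isOpen_ne_fun (continuous_wedge_pullback hF hG) continuous_const

/-- **The density step**: if some `γ₀ ∈ U(2,1)` has a non-zero wedge at `z`, then so does some element of
every dense subgroup `Δ ≤ U(2,1)`. -/
theorem exists_mem_wedge_ne_of_dense {Δ : Subgroup U21} (hΔ : Dense (Δ : Set U21))
    {F G : Ball → Fin 2 → ℂ} (hF : Continuous F) (hG : Continuous G) {z : Ball} {γ₀ : U21}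
    (h₀ : wedge ((Jac γ₀ z)ᵀ *ᵥ F (act γ₀ z)) (G z) ≠ 0) :
    ∃ γ ∈ Δ, wedge ((Jac γ z)ᵀ *ᵥ F (act γ z)) (G z) ≠ 0 := by
  obtain ⟨γ, hγΔ, hγ⟩ := hΔ.exists_mem_open (isOpen_wedge_ne hF hG z) ⟨γ₀, h₀⟩
  exact ⟨γ, hγΔ, hγ⟩

/-! ### The topology of `U21` is induced by `g ↦ mat g`

Inversion on `U(2,1)` is the continuous map `g ↦ J gᴴ J`, so the Units topology of `GL₃(ℂ)` restricted to
`U21` coincides with the topology induced by the matrix entries alone: `mat` is inducing.  Hence a density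
hypothesis on a subgroup `Δ ≤ U21` can be read in matrix space (`dense_iff_mat`). -/

/-- `J * J = 1`. -/
theorem J_mul_J : J * J = 1 := by
  ext i j
  fin_cases i <;> fin_cases j <;> simp [J]

/-- `mat g * mat g⁻¹ = 1`. -/
theorem mat_mul_mat_inv (g : U21) : mat g * mat g⁻¹ = 1 := by
  rw [mat, mat, Subgroup.coe_inv, Units.mul_inv]

/-- On `U(2,1)` the inverse is `g⁻¹ = J gᴴ J`. -/
theorem mat_inv (g : U21) : mat g⁻¹ = J * (mat g)ᴴ * J := by
  have h := mat_mem g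
  have h2 : (mat g)ᴴ * J = J * mat g⁻¹ := by
    calc (mat g)ᴴ * J = (mat g)ᴴ * J * (mat g * mat g⁻¹) := by rw [mat_mul_mat_inv, Matrix.mul_one]
      _ = ((mat g)ᴴ * J * mat g) * mat g⁻¹ := by simp only [Matrix.mul_assoc]
      _ = J * mat g⁻¹ := by rw [h]
  symm
  calc J * (mat g)ᴴ * J = J * ((mat g)ᴴ * J) := by rw [Matrix.mul_assoc]
    _ = J * (J * mat g⁻¹) := by rw [h2]
    _ = mat g⁻¹ := by rw [← Matrix.mul_assoc, J_mul_J, Matrix.one_mul]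

/-- The inverse, read in `GL₃(ℂ)`, as a function of `mat g`. -/
theorem coe_inv_eq (g : U21) : ((g : GL3)⁻¹ : GL3).val = J * (mat g)ᴴ * J := by
  rw [← mat_inv]
  rfl

/-- **`mat` is inducing**: the topology of `U21` (subspace of the Units topology of `GL₃(ℂ)`) is the
topology induced by `g ↦ mat g ∈ Matrix (Fin 3) (Fin 3) ℂ`. -/
theorem isInducing_mat : Topology.IsInducing (mat : U21 → Matrix (Fin 3) (Fin 3) ℂ) := by
  constructor
  apply le_antisymm
  · exact continuous_iff_le_induced.1 continuous_mat
  · letI τ : TopologicalSpace U21 := TopologicalSpace.induced mat inferInstance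
    have hval : @Continuous U21 GL3 τ _ (Subtype.val : U21 → GL3) := by
      rw [Units.continuous_iff]
      constructor
      · exact continuous_induced_dom
      · have hfun : (fun g : U21 => ((g : GL3)⁻¹ : GL3).val) = fun g => J * (mat g)ᴴ * J := by
          funext g
          exact coe_inv_eq g
        show @Continuous U21 _ τ _ (fun g : U21 => ((g : GL3)⁻¹ : GL3).val)
        rw [hfun]
        have hmat : @Continuous U21 _ τ _ mat := continuous_induced_dom
        exact (continuous_const.matrix_mul hmat.matrix_conjTranspose).matrix_mul continuous_const
    exact continuous_iff_le_induced.1 hval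

/-- A subset `Δ ⊆ U21` is dense iff every `mat g` lies in the closure of `mat '' Δ` (density read in matrix
space). -/
theorem dense_iff_mat (Δ : Set U21) : Dense Δ ↔ ∀ g : U21, mat g ∈ closure (mat '' Δ) :=
  isInducing_mat.dense_iff

/-- Continuity into `U21` can be tested on the matrix entries. -/
theorem continuous_iff_mat {X : Type*} [TopologicalSpace X] (f : X → U21) :
    Continuous f ↔ Continuous fun x => mat (f x) :=
  isInducing_mat.continuous_iff

end Summit.Ventures.HodgeRepro.BallModel

end
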